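import Literature.InformationTheory.Entanglement.WernerStateSeparabilityDimD
import HarnessLib

/-!
# The Werner states `W_N = (N³−N)⁻¹{(N−φ)𝟙 + (Nφ−1)V}` satisfy the reduction criterion for `2−N ≤ φ ≤ N` — hence for
# `N ≥ 3` every entangled Werner state (`φ < 0`) is NPT yet passes the reduction criterion (M. & P. Horodecki 1999, § IV)

Hodge foundations lane (`lit-hodgefound`, prover p24 gen 77; quantum-information series, sequel of
`SymmetricStatesNegativity.lean` and `WernerStateSeparabilityDimD.lean`).  THEOREMS ONLY: no definition, no named fact,
net debt 0; `𝒩(A) = Σ_i λ_i(A)⁻`.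

## Source, VERBATIM — M. Horodecki, P. Horodecki, *Reduction criterion of separability and limits for a class of
distillation protocols*, Phys. Rev. A **59** (1999) 4206 [HorodeckiHorodecki1999], § IV (held `paper:arxiv-quant-ph_9708015`,
chunk p0007)

«Thus we see, that the reduction criterion is not stronger than the Peres one. On the other hand, there exist states which
satisfy the reduction criterion but violate the Peres one. These are the Werner states [Werner] `W_N` of `N × N` system
given by `W_N = (N³ − N)⁻¹{(N − φ)I + (Nφ − 1)V}` where `−1 ≤ φ ≤ 1` and `V` is defined as `Vφ ⊗ φ̃ = φ̃ ⊗ φ`. The states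
are inseparable for `φ < 0`. … It can be seen that all for `N ≥ 3` inseparable Werner states violate partial transposition
criterion satisfying the reduction one. Indeed they have maximally mixed reductions and the norm less than `1/N`, hence
the inequality (19) cannot be violated (explicitly the reduction criterion for Werner states writes as `2 − N ≤ φ ≤ N`
which is satisfied for `N ≥ 3`)».

## Dictionary

`V = swapOp n`, `N = |n|`, `W_N(φ) = ((N³−N)⁻¹)·((N−φ)·𝟙 + (Nφ−1)·V)` written out (no definition); the reduction map is
the tree's `PPT.redB ρ = (Tr_B ρ) ⊗ 𝟙 − ρ`; «inseparable» = `¬ PPT.IsSeparable`; `φ = tr(W_N V)` (VW's `g`, B&Ż's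
`1 − 2p`: `W_N(φ)` is the B&Ż Werner state `ρ_W((1−φ)/2)`).

## What is formalized (all PROVED)

* `hhWerner_eq_symmetric` / `hhWerner_eq_bzWerner` (coordinates), `trace_hhWerner` (`= 1`), `trace_hhWerner_mul_swapOp`
  (`= φ`), `posSemidef_hhWerner` (`−1 ≤ φ ≤ 1`);
* `trB_swapOp` (`Tr_B V = 𝟙`), **`trB_hhWerner`** («maximally mixed reductions»: `Tr_B W_N = 𝟙/N`), `redB_hhWerner`;
* **`posSemidef_redB_hhWerner_iff`** («the reduction criterion for Werner states writes as `2 − N ≤ φ ≤ N`»: for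
  `−1 ≤ φ ≤ 1`, `redB W_N ⪰ 0 ↔ 2 − N ≤ φ`), `posSemidef_redB_hhWerner` («satisfied for `N ≥ 3`»);
* **`sum_negPart_eigenvalues_ptB_hhWerner`** (`𝒩(W_N^{T_B}) = (φ/N)⁻`), `not_posSemidef_ptB_hhWerner` («violate partial
  transposition» for `φ < 0`), **`not_isSeparable_hhWerner`** («inseparable for `φ < 0`»), `isSeparable_hhWerner_iff`
  (separable iff `0 ≤ φ`, from `WernerStateSeparabilityDimD`);
* **`hhWerner_reduction_blind`**: for `N ≥ 3` and `−1 ≤ φ < 0`, `W_N` is entangled, NPT, and `redB W_N ⪰ 0`.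

## Tree search (2026-08-31)

`WernerStateSeparability.lean` § ReductionQubit treats `N = 2` (`redB_eq_localConj_ptB`: reduction = PPT for qubits) and the
isotropic states; `rg -n "2 - N|reduction.*Werner"` → ∅.  REUSED: `SymmetricStatesNegativity.{sum_negPart_eigenvalues_symmetric,
sum_negPart_eigenvalues_ptB_symmetric}`, `MaximallyEntangledPartialTranspose.{trace_swapOp, isHermitian_swapOp}`,
`WernerStateSeparabilityDimD.{isSeparable_werner, not_isSeparable_werner}`, `Negativity.sum_negPart_eigenvalues_eq_zero_iff`,
`PPT.{redB_apply, trB_apply, trB_kronecker, IsSeparable.posSemidef_ptB}`.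

presearch: «Werner states reduction criterion 2−N ≤ φ ≤ N maximally mixed reductions NPT but reduction satisfied» →
[corpus: arxiv quant-ph/9708015 § IV]; [corpus: bertlmann2023 § 15.4.3 (reduction criterion, qubit case)]; galaxy
`"reduction criterion|Werner state"` (pdf) → HH99, Cerf–Adami–Gingrich 1999.

## References

* [HorodeckiHorodecki1999] § IV (the Werner states `W_N`; «2 − N ≤ φ ≤ N»).
* [VidalWerner2002] § V.B; [BengtssonZyczkowski2017] § 16.6 eq. (16.53) (the same family).
-/

noncomputable section

open Matrix Finset
open scoped ComplexOrder Kronecker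

namespace Literature.InformationTheory.Entanglement.WernerReductionCriterion

open Literature.InformationTheory.Entanglement.PPT (ptB redB redB_apply trB trB_apply trB_kronecker maxEnt IsSeparable)
open Literature.InformationTheory.Entanglement.MaximallyEntangledPartialTranspose (trace_swapOp isHermitian_swapOp)
open Literature.InformationTheory.Entanglement.SymmetricStatesNegativity (sum_negPart_eigenvalues_symmetric
  sum_negPart_eigenvalues_ptB_symmetric)
open Literature.InformationTheory.Entanglement.WernerStateSeparabilityDimD (isSeparable_werner not_isSeparable_werner)
open Literature.InformationTheory.Entanglement.Negativity (sum_negPart_eigenvalues_eq_zero_iff)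
open Literature.InformationTheory.Entanglement.MaximalBallPPT (isHermitian_ptB)
open Literature.Computability.QuantumComplexity.DesignAnticoncentration (swapOp)

variable {n : Type*} [Fintype n] [DecidableEq n]

/-! ## § 1. Coordinates, trace, `φ = tr(W_N V)`, positivity -/

/-- `W_N(φ)` in the `{V, |Φ⁺⟩⟨Φ⁺|, 𝟙}` coordinates of `SymmetricStatesNegativity`: `α = (Nφ−1)/(N³−N)`, `β = 0`,
`γ = (N−φ)/(N³−N)`. [cite: HorodeckiHorodecki1999, § IV (the definition of `W_N`)] -/
theorem hhWerner_eq_symmetric (φ : ℝ) :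
    (((((Fintype.card n : ℝ)) ^ 3 - Fintype.card n)⁻¹ : ℝ) : ℂ) •
        (((Fintype.card n - φ : ℝ) : ℂ) • (1 : Matrix (n × n) (n × n) ℂ) +
          (((Fintype.card n * φ - 1 : ℝ)) : ℂ) • swapOp n) =
      (((Fintype.card n * φ - 1) / ((Fintype.card n : ℝ) ^ 3 - Fintype.card n) : ℝ) : ℂ) • swapOp n +
        ((0 : ℝ) : ℂ) • vecMulVec (maxEnt n) (star (maxEnt n)) +
        (((Fintype.card n - φ) / ((Fintype.card n : ℝ) ^ 3 - Fintype.card n) : ℝ) : ℂ) •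
          (1 : Matrix (n × n) (n × n) ℂ) := by
  rw [smul_add, smul_smul, smul_smul, Complex.ofReal_zero, zero_smul, add_zero]
  push_cast
  module

/-- **`W_N(φ)` is the Bengtsson–Życzkowski Werner state `ρ_W(p)` with `p = (1−φ)/2`** (`N ≥ 2`).
[cite: HorodeckiHorodecki1999, § IV] [cite: BengtssonZyczkowski2017, § 16.6 eq. (16.53)] -/
theorem hhWerner_eq_bzWerner (hN : 2 ≤ Fintype.card n) (φ : ℝ) :
    (((((Fintype.card n : ℝ)) ^ 3 - Fintype.card n)⁻¹ : ℝ) : ℂ) •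
        (((Fintype.card n - φ : ℝ) : ℂ) • (1 : Matrix (n × n) (n × n) ℂ) +
          (((Fintype.card n * φ - 1 : ℝ)) : ℂ) • swapOp n) =
      (((1 - (1 - φ) / 2) * (2 / ((Fintype.card n : ℝ) * (Fintype.card n + 1))) : ℝ) : ℂ) •
          (((1 / 2 : ℝ) : ℂ) • ((1 : Matrix (n × n) (n × n) ℂ) + swapOp n)) +
        ((((1 - φ) / 2 * (2 / ((Fintype.card n : ℝ) * (Fintype.card n - 1)))) : ℝ) : ℂ) •
          (((1 / 2 : ℝ) : ℂ) • ((1 : Matrix (n × n) (n × n) ℂ) - swapOp n)) := by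
  have hN' : (2 : ℝ) ≤ Fintype.card n := by exact_mod_cast hN
  have h1 : (Fintype.card n : ℝ) - 1 ≠ 0 := by linarith
  have h2 : (Fintype.card n : ℝ) + 1 ≠ 0 := by linarith
  have h3 : (Fintype.card n : ℝ) ≠ 0 := by linarith
  have hc : (Fintype.card n : ℝ) ^ 3 - Fintype.card n = Fintype.card n * (Fintype.card n + 1) * (Fintype.card n - 1) := by
    ring
  -- compare the coefficients of `𝟙` and `V`
  have hV : ((Fintype.card n : ℝ) ^ 3 - Fintype.card n)⁻¹ * (Fintype.card n * φ - 1) =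
      (1 - (1 - φ) / 2) * (2 / ((Fintype.card n : ℝ) * (Fintype.card n + 1))) * (1 / 2) -
        (1 - φ) / 2 * (2 / ((Fintype.card n : ℝ) * (Fintype.card n - 1))) * (1 / 2) := by
    rw [hc]; field_simp; ring
  have hI : ((Fintype.card n : ℝ) ^ 3 - Fintype.card n)⁻¹ * (Fintype.card n - φ) =
      (1 - (1 - φ) / 2) * (2 / ((Fintype.card n : ℝ) * (Fintype.card n + 1))) * (1 / 2) +
        (1 - φ) / 2 * (2 / ((Fintype.card n : ℝ) * (Fintype.card n - 1))) * (1 / 2) := by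
    rw [hc]; field_simp; ring
  rw [smul_add, smul_smul, smul_smul, smul_smul, smul_smul, smul_add, smul_sub, ← Complex.ofReal_mul,
    ← Complex.ofReal_mul, ← Complex.ofReal_mul, ← Complex.ofReal_mul, hV, hI]
  push_cast
  module

/-- `W_N(φ)` is Hermitian. [cite: HorodeckiHorodecki1999, § IV] -/
private theorem isHermitian_hhWerner (φ : ℝ) :
    ((((((Fintype.card n : ℝ)) ^ 3 - Fintype.card n)⁻¹ : ℝ) : ℂ) •
        (((Fintype.card n - φ : ℝ) : ℂ) • (1 : Matrix (n × n) (n × n) ℂ) +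
          (((Fintype.card n * φ - 1 : ℝ)) : ℂ) • swapOp n)).IsHermitian := by
  have hV := (isHermitian_swapOp (n := n)).eq
  change (_ : Matrix (n × n) (n × n) ℂ)ᴴ = _
  rw [conjTranspose_smul, conjTranspose_add, conjTranspose_smul, conjTranspose_smul, conjTranspose_one, hV,
    Complex.star_def, Complex.conj_ofReal, Complex.conj_ofReal, Complex.conj_ofReal]

/-- **`Tr W_N = 1`** (`N ≥ 2`). [cite: HorodeckiHorodecki1999, § IV] -/
theorem trace_hhWerner (hN : 2 ≤ Fintype.card n) (φ : ℝ) :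
    ((((((Fintype.card n : ℝ)) ^ 3 - Fintype.card n)⁻¹ : ℝ) : ℂ) •
        (((Fintype.card n - φ : ℝ) : ℂ) • (1 : Matrix (n × n) (n × n) ℂ) +
          (((Fintype.card n * φ - 1 : ℝ)) : ℂ) • swapOp n)).trace = 1 := by
  have hN' : (2 : ℝ) ≤ Fintype.card n := by exact_mod_cast hN
  have hc : (Fintype.card n : ℝ) ^ 3 - Fintype.card n ≠ 0 := by
    rw [show (Fintype.card n : ℝ) ^ 3 - Fintype.card n = Fintype.card n * (Fintype.card n + 1) * (Fintype.card n - 1) by ring]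
    exact mul_ne_zero (mul_ne_zero (by linarith) (by linarith)) (by linarith)
  have hcC : ((Fintype.card n : ℂ)) ^ 3 - (Fintype.card n : ℂ) ≠ 0 := by exact_mod_cast hc
  have hNC : (Fintype.card n : ℂ) ≠ 0 := by exact_mod_cast (show (Fintype.card n : ℝ) ≠ 0 by linarith)
  have hsqC : (Fintype.card n : ℂ) ^ 2 - 1 ≠ 0 := by exact_mod_cast (show (Fintype.card n : ℝ) ^ 2 - 1 ≠ 0 by nlinarith)
  rw [trace_smul, trace_add, trace_smul, trace_smul, trace_one, trace_swapOp, Fintype.card_prod, smul_eq_mul, smul_eq_mul,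
    smul_eq_mul]
  push_cast
  field_simp
  ring

omit [Fintype n] in
/-- Entries of the flip. [folklore] -/
private theorem swapOp_apply (p q : n × n) : swapOp n p q = if p.1 = q.2 ∧ p.2 = q.1 then 1 else 0 := rfl

/-- `V² = 𝟙`. [folklore] -/
private theorem swapOp_mul_swapOp : swapOp n * swapOp n = (1 : Matrix (n × n) (n × n) ℂ) := by
  ext ⟨a, c⟩ ⟨b, d⟩
  rw [mul_apply, Fintype.sum_prod_type, one_apply]
  simp only [swapOp_apply]
  rw [Finset.sum_eq_single c]
  · rw [Finset.sum_eq_single a]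
    · simp only [and_self, if_true, one_mul, Prod.mk.injEq]
      by_cases h : a = b ∧ c = d
      · rw [if_pos ⟨h.2, h.1⟩, if_pos h]
      · rw [if_neg (fun h' => h ⟨h'.2, h'.1⟩), if_neg h]
    · intro s _ hs; rw [if_neg (fun h => hs h.1.symm), zero_mul]
    · intro h; exact absurd (mem_univ _) h
  · intro r _ hr
    exact Finset.sum_eq_zero fun s _ => by rw [if_neg (fun h => hr h.2.symm), zero_mul]
  · intro h; exact absurd (mem_univ _) h

/-- **`φ = tr(W_N V)`.** [cite: HorodeckiHorodecki1999, § IV] [cite: VidalWerner2002, § V.B (`g = tr(ρ𝔽)`)] -/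
theorem trace_hhWerner_mul_swapOp (hN : 2 ≤ Fintype.card n) (φ : ℝ) :
    (((((((Fintype.card n : ℝ)) ^ 3 - Fintype.card n)⁻¹ : ℝ) : ℂ) •
        (((Fintype.card n - φ : ℝ) : ℂ) • (1 : Matrix (n × n) (n × n) ℂ) +
          (((Fintype.card n * φ - 1 : ℝ)) : ℂ) • swapOp n)) * swapOp n).trace = (φ : ℂ) := by
  have hN' : (2 : ℝ) ≤ Fintype.card n := by exact_mod_cast hN
  have hc : (Fintype.card n : ℝ) ^ 3 - Fintype.card n ≠ 0 := by
    rw [show (Fintype.card n : ℝ) ^ 3 - Fintype.card n = Fintype.card n * (Fintype.card n + 1) * (Fintype.card n - 1) by ring]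
    exact mul_ne_zero (mul_ne_zero (by linarith) (by linarith)) (by linarith)
  have hcC : ((Fintype.card n : ℂ)) ^ 3 - (Fintype.card n : ℂ) ≠ 0 := by exact_mod_cast hc
  have hNC : (Fintype.card n : ℂ) ≠ 0 := by exact_mod_cast (show (Fintype.card n : ℝ) ≠ 0 by linarith)
  have hsqC : (Fintype.card n : ℂ) ^ 2 - 1 ≠ 0 := by exact_mod_cast (show (Fintype.card n : ℝ) ^ 2 - 1 ≠ 0 by nlinarith)
  rw [Matrix.smul_mul, Matrix.add_mul, Matrix.smul_mul, Matrix.smul_mul, Matrix.one_mul, swapOp_mul_swapOp, trace_smul,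
    trace_add, trace_smul, trace_smul, trace_one, trace_swapOp, Fintype.card_prod, smul_eq_mul, smul_eq_mul, smul_eq_mul]
  push_cast
  field_simp
  ring

/-- **`W_N(φ) ⪰ 0` for `−1 ≤ φ ≤ 1`** (eigenvalue `(N−1)(1+φ)/(N³−N)` on the symmetric and `(N+1)(1−φ)/(N³−N)` on the
antisymmetric subspace). [cite: HorodeckiHorodecki1999, § IV («where `−1 ≤ φ ≤ 1`»)] -/
theorem posSemidef_hhWerner (hN : 2 ≤ Fintype.card n) {φ : ℝ} (hlo : -1 ≤ φ) (hhi : φ ≤ 1) :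
    ((((((Fintype.card n : ℝ)) ^ 3 - Fintype.card n)⁻¹ : ℝ) : ℂ) •
        (((Fintype.card n - φ : ℝ) : ℂ) • (1 : Matrix (n × n) (n × n) ℂ) +
          (((Fintype.card n * φ - 1 : ℝ)) : ℂ) • swapOp n)).PosSemidef := by
  haveI : Nonempty n := Fintype.card_pos_iff.1 (by omega)
  have hN' : (2 : ℝ) ≤ Fintype.card n := by exact_mod_cast hN
  have hcpos : 0 < (Fintype.card n : ℝ) ^ 3 - Fintype.card n := by
    rw [show (Fintype.card n : ℝ) ^ 3 - Fintype.card n = Fintype.card n * (Fintype.card n + 1) * (Fintype.card n - 1) by ring]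
    exact mul_pos (mul_pos (by linarith) (by linarith)) (by linarith)
  have hH := isHermitian_hhWerner (n := n) φ
  refine (sum_negPart_eigenvalues_eq_zero_iff hH).1 ?_
  have hH' := hH
  rw [hhWerner_eq_symmetric] at hH'
  have key : ∀ (X Y : Matrix (n × n) (n × n) ℂ) (hX : X.IsHermitian) (hY : Y.IsHermitian), X = Y →
      ∑ i, (hX.eigenvalues i)⁻ = ∑ i, (hY.eigenvalues i)⁻ := by
    rintro X Y hX hY rfl; rfl
  rw [key _ _ hH hH' (hhWerner_eq_symmetric φ), sum_negPart_eigenvalues_symmetric]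
  have h1 : 0 ≤ (Fintype.card n * φ - 1) / ((Fintype.card n : ℝ) ^ 3 - Fintype.card n) + 0 +
      (Fintype.card n - φ) / ((Fintype.card n : ℝ) ^ 3 - Fintype.card n) := by
    rw [add_zero, ← add_div]; exact div_nonneg (by nlinarith) hcpos.le
  have h2 : 0 ≤ (Fintype.card n - φ) / ((Fintype.card n : ℝ) ^ 3 - Fintype.card n) -
      (Fintype.card n * φ - 1) / ((Fintype.card n : ℝ) ^ 3 - Fintype.card n) := by
    rw [← sub_div]; exact div_nonneg (by nlinarith) hcpos.le
  have h3 : 0 ≤ (Fintype.card n * φ - 1) / ((Fintype.card n : ℝ) ^ 3 - Fintype.card n) +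
      (Fintype.card n - φ) / ((Fintype.card n : ℝ) ^ 3 - Fintype.card n) := by
    rw [← add_div]; exact div_nonneg (by nlinarith) hcpos.le
  rw [negPart_eq_zero.2 h1, negPart_eq_zero.2 h2, negPart_eq_zero.2 h3]
  ring

/-! ## § 2. «maximally mixed reductions» and the reduction map -/

omit [DecidableEq n] in
/-- `Tr_B V = 𝟙` (the flip has maximally mixed marginals up to the factor `N`). [cite: HorodeckiHorodecki1999, § IV
(«they have maximally mixed reductions»)] -/
theorem trB_swapOp [DecidableEq n] : trB (swapOp n) = (1 : Matrix n n ℂ) := by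
  ext i j
  rw [trB_apply, one_apply]
  simp only [swapOp_apply]
  by_cases h : i = j
  · subst h
    rw [Finset.sum_eq_single i]
    · simp
    · intro k _ hk; rw [if_neg (fun h => hk h.1.symm)]
    · intro h; exact absurd (mem_univ _) h
  · rw [if_neg h]
    exact Finset.sum_eq_zero fun k _ => if_neg fun hk => h (hk.1.trans hk.2)

/-- **«they have maximally mixed reductions»: `Tr_B W_N = 𝟙/N`.** [cite: HorodeckiHorodecki1999, § IV] -/
theorem trB_hhWerner (hN : 2 ≤ Fintype.card n) (φ : ℝ) :
    trB ((((((Fintype.card n : ℝ)) ^ 3 - Fintype.card n)⁻¹ : ℝ) : ℂ) •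
        (((Fintype.card n - φ : ℝ) : ℂ) • (1 : Matrix (n × n) (n × n) ℂ) +
          (((Fintype.card n * φ - 1 : ℝ)) : ℂ) • swapOp n)) =
      ((((Fintype.card n : ℝ))⁻¹ : ℝ) : ℂ) • (1 : Matrix n n ℂ) := by
  have hN' : (2 : ℝ) ≤ Fintype.card n := by exact_mod_cast hN
  have h3 : (Fintype.card n : ℝ) ≠ 0 := by linarith
  have hc : (Fintype.card n : ℝ) ^ 3 - Fintype.card n ≠ 0 := by
    rw [show (Fintype.card n : ℝ) ^ 3 - Fintype.card n = Fintype.card n * (Fintype.card n + 1) * (Fintype.card n - 1) by ring]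
    exact mul_ne_zero (mul_ne_zero h3 (by linarith)) (by linarith)
  have h1k : trB (1 : Matrix (n × n) (n × n) ℂ) = (Fintype.card n : ℂ) • (1 : Matrix n n ℂ) := by
    rw [← one_kronecker_one, trB_kronecker, trace_one]
  rw [map_smul, map_add, map_smul, map_smul, h1k, trB_swapOp, smul_smul, ← add_smul, smul_smul]
  congr 1
  have hcC : ((Fintype.card n : ℂ)) ^ 3 - (Fintype.card n : ℂ) ≠ 0 := by exact_mod_cast hc
  have h3C : (Fintype.card n : ℂ) ≠ 0 := by exact_mod_cast h3
  have hsqC : (Fintype.card n : ℂ) ^ 2 - 1 ≠ 0 := by exact_mod_cast (show (Fintype.card n : ℝ) ^ 2 - 1 ≠ 0 by nlinarith)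
  push_cast
  field_simp
  ring

/-- **The reduction operator of `W_N`: `(Tr_B W_N) ⊗ 𝟙 − W_N = γ'𝟙 + α'V`** with `γ' = (N² − N − 1 + φ)/(N³−N)`,
`α' = −(Nφ−1)/(N³−N)` (in the `{V, |Φ⁺⟩⟨Φ⁺|, 𝟙}` coordinates). [cite: HorodeckiHorodecki1999, § IV] -/
theorem redB_hhWerner (hN : 2 ≤ Fintype.card n) (φ : ℝ) :
    redB ((((((Fintype.card n : ℝ)) ^ 3 - Fintype.card n)⁻¹ : ℝ) : ℂ) •
        (((Fintype.card n - φ : ℝ) : ℂ) • (1 : Matrix (n × n) (n × n) ℂ) +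
          (((Fintype.card n * φ - 1 : ℝ)) : ℂ) • swapOp n)) =
      ((-(Fintype.card n * φ - 1) / ((Fintype.card n : ℝ) ^ 3 - Fintype.card n) : ℝ) : ℂ) • swapOp n +
        ((0 : ℝ) : ℂ) • vecMulVec (maxEnt n) (star (maxEnt n)) +
        ((((Fintype.card n : ℝ) ^ 2 - Fintype.card n - 1 + φ) / ((Fintype.card n : ℝ) ^ 3 - Fintype.card n) : ℝ) : ℂ) •
          (1 : Matrix (n × n) (n × n) ℂ) := by
  have hN' : (2 : ℝ) ≤ Fintype.card n := by exact_mod_cast hN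
  have h3 : (Fintype.card n : ℝ) ≠ 0 := by linarith
  have hc : (Fintype.card n : ℝ) ^ 3 - Fintype.card n ≠ 0 := by
    rw [show (Fintype.card n : ℝ) ^ 3 - Fintype.card n = Fintype.card n * (Fintype.card n + 1) * (Fintype.card n - 1) by ring]
    exact mul_ne_zero (mul_ne_zero h3 (by linarith)) (by linarith)
  have hsq : (Fintype.card n : ℝ) ^ 2 - 1 ≠ 0 := by nlinarith
  have hinv : ((Fintype.card n : ℝ))⁻¹ = ((Fintype.card n : ℝ) ^ 2 - 1) / ((Fintype.card n : ℝ) ^ 3 - Fintype.card n) := by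
    field_simp
  rw [redB_apply, trB_hhWerner hN, hinv, Matrix.smul_kronecker, one_kronecker_one, Complex.ofReal_zero, zero_smul,
    add_zero, smul_add, smul_smul, smul_smul]
  push_cast
  module

/-- The reduction operator of `W_N` is Hermitian. [cite: HorodeckiHorodecki1999, § IV] -/
private theorem isHermitian_redB_hhWerner (hN : 2 ≤ Fintype.card n) (φ : ℝ) :
    (redB ((((((Fintype.card n : ℝ)) ^ 3 - Fintype.card n)⁻¹ : ℝ) : ℂ) •
        (((Fintype.card n - φ : ℝ) : ℂ) • (1 : Matrix (n × n) (n × n) ℂ) +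
          (((Fintype.card n * φ - 1 : ℝ)) : ℂ) • swapOp n))).IsHermitian := by
  have hV := (isHermitian_swapOp (n := n)).eq
  rw [redB_hhWerner hN, Complex.ofReal_zero, zero_smul, add_zero]
  change (_ : Matrix (n × n) (n × n) ℂ)ᴴ = _
  rw [conjTranspose_add, conjTranspose_smul, conjTranspose_smul, conjTranspose_one, hV, Complex.star_def,
    Complex.conj_ofReal, Complex.conj_ofReal]

/-- **«the reduction criterion for Werner states writes as `2 − N ≤ φ ≤ N`»**: for `−1 ≤ φ ≤ 1` (`N ≥ 2`),
`(Tr_B W_N) ⊗ 𝟙 − W_N ⪰ 0 ↔ 2 − N ≤ φ` (the eigenvalue on the antisymmetric subspace is `(N+1)(N−2+φ)/(N³−N)`, the one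
on the symmetric subspace `(N−1)(N−φ)/(N³−N) ≥ 0`). [cite: HorodeckiHorodecki1999, § IV] -/
theorem posSemidef_redB_hhWerner_iff (hN : 2 ≤ Fintype.card n) {φ : ℝ} (hlo : -1 ≤ φ) (hhi : φ ≤ 1) :
    (redB ((((((Fintype.card n : ℝ)) ^ 3 - Fintype.card n)⁻¹ : ℝ) : ℂ) •
        (((Fintype.card n - φ : ℝ) : ℂ) • (1 : Matrix (n × n) (n × n) ℂ) +
          (((Fintype.card n * φ - 1 : ℝ)) : ℂ) • swapOp n))).PosSemidef ↔ 2 - (Fintype.card n : ℝ) ≤ φ := by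
  haveI : Nonempty n := Fintype.card_pos_iff.1 (by omega)
  have hN' : (2 : ℝ) ≤ Fintype.card n := by exact_mod_cast hN
  have hcpos : 0 < (Fintype.card n : ℝ) ^ 3 - Fintype.card n := by
    rw [show (Fintype.card n : ℝ) ^ 3 - Fintype.card n = Fintype.card n * (Fintype.card n + 1) * (Fintype.card n - 1) by ring]
    exact mul_pos (mul_pos (by linarith) (by linarith)) (by linarith)
  have hH := isHermitian_redB_hhWerner (n := n) hN φ
  have hH' := hH
  rw [redB_hhWerner hN] at hH'
  have key : ∀ (X Y : Matrix (n × n) (n × n) ℂ) (hX : X.IsHermitian) (hY : Y.IsHermitian), X = Y →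
      ∑ i, (hX.eigenvalues i)⁻ = ∑ i, (hY.eigenvalues i)⁻ := by
    rintro X Y hX hY rfl; rfl
  rw [← sum_negPart_eigenvalues_eq_zero_iff hH, key _ _ hH hH' (redB_hhWerner hN φ), sum_negPart_eigenvalues_symmetric]
  -- the symmetric eigenvalue `α' + γ' = (N−1)(N−φ)/(N³−N) ≥ 0`
  have hsym : 0 ≤ -(Fintype.card n * φ - 1) / ((Fintype.card n : ℝ) ^ 3 - Fintype.card n) +
      ((Fintype.card n : ℝ) ^ 2 - Fintype.card n - 1 + φ) / ((Fintype.card n : ℝ) ^ 3 - Fintype.card n) := by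
    rw [← add_div]; exact div_nonneg (by nlinarith) hcpos.le
  -- the antisymmetric eigenvalue `γ' − α' = (N+1)(N−2+φ)/(N³−N)`
  have hanti : ((Fintype.card n : ℝ) ^ 2 - Fintype.card n - 1 + φ) / ((Fintype.card n : ℝ) ^ 3 - Fintype.card n) -
      -(Fintype.card n * φ - 1) / ((Fintype.card n : ℝ) ^ 3 - Fintype.card n) =
      ((Fintype.card n : ℝ) + 1) * (Fintype.card n - 2 + φ) / ((Fintype.card n : ℝ) ^ 3 - Fintype.card n) := by
    rw [← sub_div]; congr 1; ring
  rw [add_zero, negPart_eq_zero.2 hsym, zero_mul, zero_add, add_zero, hanti]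
  have hk : (0 : ℝ) < ((Fintype.card n : ℝ) ^ 2 - Fintype.card n) / 2 := by nlinarith
  constructor
  · intro h
    have h0 : (((Fintype.card n : ℝ) + 1) * (Fintype.card n - 2 + φ) / ((Fintype.card n : ℝ) ^ 3 - Fintype.card n))⁻ = 0 := by
      rcases mul_eq_zero.1 h with h1 | h2
      · exact h1
      · exact absurd h2 hk.ne'
    rw [negPart_eq_zero, div_nonneg_iff] at h0
    rcases h0 with ⟨h1, -⟩ | ⟨-, h2⟩
    · have : 0 ≤ (Fintype.card n : ℝ) - 2 + φ := by
        by_contra hneg; push Not at hneg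
        have : ((Fintype.card n : ℝ) + 1) * (Fintype.card n - 2 + φ) < 0 := mul_neg_of_pos_of_neg (by linarith) hneg
        linarith
      linarith
    · exact absurd h2 (not_le.2 hcpos)
  · intro h
    rw [negPart_eq_zero.2 (div_nonneg (mul_nonneg (by linarith) (by linarith)) hcpos.le), zero_mul]

/-- **«which is satisfied for `N ≥ 3`»**: every Werner state `W_N(φ)`, `−1 ≤ φ ≤ 1`, `N ≥ 3`, satisfies the reduction
criterion. [cite: HorodeckiHorodecki1999, § IV] -/
theorem posSemidef_redB_hhWerner (hN : 3 ≤ Fintype.card n) {φ : ℝ} (hlo : -1 ≤ φ) (hhi : φ ≤ 1) :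
    (redB ((((((Fintype.card n : ℝ)) ^ 3 - Fintype.card n)⁻¹ : ℝ) : ℂ) •
        (((Fintype.card n - φ : ℝ) : ℂ) • (1 : Matrix (n × n) (n × n) ℂ) +
          (((Fintype.card n * φ - 1 : ℝ)) : ℂ) • swapOp n))).PosSemidef := by
  have hN' : (3 : ℝ) ≤ Fintype.card n := by exact_mod_cast hN
  exact (posSemidef_redB_hhWerner_iff (by omega) hlo hhi).2 (by linarith)

/-! ## § 3. «violate partial transposition», «inseparable for `φ < 0`» -/

/-- **`𝒩(W_N^{T_B}) = (φ/N)⁻`**: the partial transpose has the eigenvalue `φ/N` on `|Φ⁺⟩` and `(N−φ)/(N³−N) ≥ 0`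
elsewhere. [cite: HorodeckiHorodecki1999, § IV] [cite: VidalWerner2002, § V.B] -/
theorem sum_negPart_eigenvalues_ptB_hhWerner (hN : 2 ≤ Fintype.card n) {φ : ℝ} (hhi : φ ≤ 1)
    (hH : (ptB ((((((Fintype.card n : ℝ)) ^ 3 - Fintype.card n)⁻¹ : ℝ) : ℂ) •
        (((Fintype.card n - φ : ℝ) : ℂ) • (1 : Matrix (n × n) (n × n) ℂ) +
          (((Fintype.card n * φ - 1 : ℝ)) : ℂ) • swapOp n))).IsHermitian) :
    ∑ j, (hH.eigenvalues j)⁻ = (φ / Fintype.card n)⁻ := by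
  haveI : Nonempty n := Fintype.card_pos_iff.1 (by omega)
  have hN' : (2 : ℝ) ≤ Fintype.card n := by exact_mod_cast hN
  have h3 : (Fintype.card n : ℝ) ≠ 0 := by linarith
  have hcpos : 0 < (Fintype.card n : ℝ) ^ 3 - Fintype.card n := by
    rw [show (Fintype.card n : ℝ) ^ 3 - Fintype.card n = Fintype.card n * (Fintype.card n + 1) * (Fintype.card n - 1) by ring]
    exact mul_pos (mul_pos (by linarith) (by linarith)) (by linarith)
  have hH' := hH
  rw [hhWerner_eq_symmetric] at hH'
  have key : ∀ (X Y : Matrix (n × n) (n × n) ℂ) (hX : X.IsHermitian) (hY : Y.IsHermitian), X = Y →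
      ∑ i, (hX.eigenvalues i)⁻ = ∑ i, (hY.eigenvalues i)⁻ := by
    rintro X Y hX hY rfl; rfl
  rw [key _ _ hH hH' (by rw [hhWerner_eq_symmetric]), sum_negPart_eigenvalues_ptB_symmetric]
  have hγ : 0 ≤ (Fintype.card n - φ) / ((Fintype.card n : ℝ) ^ 3 - Fintype.card n) := div_nonneg (by linarith) hcpos.le
  have hc : (Fintype.card n : ℝ) ^ 3 - Fintype.card n ≠ 0 := hcpos.ne'
  have hsq : (Fintype.card n : ℝ) ^ 2 - 1 ≠ 0 := by nlinarith
  have hev : 0 / (Fintype.card n : ℝ) + (Fintype.card n * φ - 1) / ((Fintype.card n : ℝ) ^ 3 - Fintype.card n) * Fintype.card n +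
      (Fintype.card n - φ) / ((Fintype.card n : ℝ) ^ 3 - Fintype.card n) = φ / Fintype.card n := by
    field_simp
    ring
  rw [hev, zero_div, sub_zero, zero_add, negPart_eq_zero.2 hγ, zero_mul, zero_mul, add_zero, add_zero]

/-- **«violate partial transposition criterion»: `W_N^{T_B}` is not positive for `φ < 0`.** [cite: HorodeckiHorodecki1999,
§ IV] -/
theorem not_posSemidef_ptB_hhWerner (hN : 2 ≤ Fintype.card n) {φ : ℝ} (hlo : -1 ≤ φ) (hφ : φ < 0) :
    ¬ (ptB ((((((Fintype.card n : ℝ)) ^ 3 - Fintype.card n)⁻¹ : ℝ) : ℂ) •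
        (((Fintype.card n - φ : ℝ) : ℂ) • (1 : Matrix (n × n) (n × n) ℂ) +
          (((Fintype.card n * φ - 1 : ℝ)) : ℂ) • swapOp n))).PosSemidef := by
  intro hpsd
  have hN' : (0 : ℝ) < Fintype.card n := by
    have : (2 : ℝ) ≤ Fintype.card n := by exact_mod_cast hN
    linarith
  have hH := isHermitian_ptB (posSemidef_hhWerner hN hlo (by linarith)).isHermitian
  have hzero := (sum_negPart_eigenvalues_eq_zero_iff hH).2 hpsd
  rw [sum_negPart_eigenvalues_ptB_hhWerner hN (by linarith) hH, negPart_eq_zero] at hzero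
  have : φ / (Fintype.card n : ℝ) < 0 := div_neg_of_neg_of_pos hφ hN'
  linarith

/-- **«The states are inseparable for `φ < 0`.»** [cite: HorodeckiHorodecki1999, § IV] -/
theorem not_isSeparable_hhWerner (hN : 2 ≤ Fintype.card n) {φ : ℝ} (hlo : -1 ≤ φ) (hφ : φ < 0) :
    ¬ IsSeparable ((((((Fintype.card n : ℝ)) ^ 3 - Fintype.card n)⁻¹ : ℝ) : ℂ) •
        (((Fintype.card n - φ : ℝ) : ℂ) • (1 : Matrix (n × n) (n × n) ℂ) +
          (((Fintype.card n * φ - 1 : ℝ)) : ℂ) • swapOp n)) :=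
  fun h => not_posSemidef_ptB_hhWerner hN hlo hφ h.posSemidef_ptB

/-- **`W_N(φ)` is separable for `0 ≤ φ ≤ 1`** (it is `ρ_W((1−φ)/2)` with `(1−φ)/2 ≤ ½`). [cite: VidalWerner2002, § V.B
(«the set of ppt-states is the same as the set of separable states … `g ∈ [0, 1]`»)] [cite: HorodeckiHorodecki1999, § IV] -/
theorem isSeparable_hhWerner (hN : 2 ≤ Fintype.card n) {φ : ℝ} (h0 : 0 ≤ φ) (h1 : φ ≤ 1) :
    IsSeparable ((((((Fintype.card n : ℝ)) ^ 3 - Fintype.card n)⁻¹ : ℝ) : ℂ) •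
        (((Fintype.card n - φ : ℝ) : ℂ) • (1 : Matrix (n × n) (n × n) ℂ) +
          (((Fintype.card n * φ - 1 : ℝ)) : ℂ) • swapOp n)) := by
  haveI : Nonempty n := Fintype.card_pos_iff.1 (by omega)
  rw [hhWerner_eq_bzWerner hN]
  exact isSeparable_werner hN (by linarith) (by linarith)

/-- **`W_N(φ)` (`−1 ≤ φ ≤ 1`, `N ≥ 2`) is separable iff `0 ≤ φ`** (iff PPT). [cite: HorodeckiHorodecki1999, § IV]
[cite: VidalWerner2002, § V.B] -/
theorem isSeparable_hhWerner_iff (hN : 2 ≤ Fintype.card n) {φ : ℝ} (hlo : -1 ≤ φ) (hhi : φ ≤ 1) :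
    IsSeparable ((((((Fintype.card n : ℝ)) ^ 3 - Fintype.card n)⁻¹ : ℝ) : ℂ) •
        (((Fintype.card n - φ : ℝ) : ℂ) • (1 : Matrix (n × n) (n × n) ℂ) +
          (((Fintype.card n * φ - 1 : ℝ)) : ℂ) • swapOp n)) ↔ 0 ≤ φ :=
  ⟨fun h => le_of_not_gt fun hφ => not_isSeparable_hhWerner hN hlo hφ h, fun h => isSeparable_hhWerner hN h hhi⟩

/-- **HH99 § IV: for `N ≥ 3` every entangled Werner state (`−1 ≤ φ < 0`) violates the partial transposition criterion
while satisfying the reduction criterion** — the reduction criterion is strictly weaker than PPT beyond qubits.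
[cite: HorodeckiHorodecki1999, § IV («all for `N ≥ 3` inseparable Werner states violate partial transposition criterion
satisfying the reduction one»)] -/
theorem hhWerner_reduction_blind (hN : 3 ≤ Fintype.card n) {φ : ℝ} (hlo : -1 ≤ φ) (hφ : φ < 0) :
    ¬ IsSeparable ((((((Fintype.card n : ℝ)) ^ 3 - Fintype.card n)⁻¹ : ℝ) : ℂ) •
        (((Fintype.card n - φ : ℝ) : ℂ) • (1 : Matrix (n × n) (n × n) ℂ) +
          (((Fintype.card n * φ - 1 : ℝ)) : ℂ) • swapOp n)) ∧
      ¬ (ptB ((((((Fintype.card n : ℝ)) ^ 3 - Fintype.card n)⁻¹ : ℝ) : ℂ) •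
        (((Fintype.card n - φ : ℝ) : ℂ) • (1 : Matrix (n × n) (n × n) ℂ) +
          (((Fintype.card n * φ - 1 : ℝ)) : ℂ) • swapOp n))).PosSemidef ∧
      (redB ((((((Fintype.card n : ℝ)) ^ 3 - Fintype.card n)⁻¹ : ℝ) : ℂ) •
        (((Fintype.card n - φ : ℝ) : ℂ) • (1 : Matrix (n × n) (n × n) ℂ) +
          (((Fintype.card n * φ - 1 : ℝ)) : ℂ) • swapOp n))).PosSemidef :=
  ⟨not_isSeparable_hhWerner (by omega) hlo hφ, not_posSemidef_ptB_hhWerner (by omega) hlo hφ,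
    posSemidef_redB_hhWerner hN hlo (hφ.le.trans (by norm_num))⟩

end Literature.InformationTheory.Entanglement.WernerReductionCriterion
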